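import Summits.KontsevichZagierPeriods.Zeta5Search.Barrier.ConeGammaPairs

/-!
# ζ(5) search — BARRIER: the torus form of Brown–Zudilin's `S₇` saving (`𝒩 : ℝ⁸/ℤ⁸ → {0,…,7}`)

HONEST FRAMING (cell `pub-zeta5`): systematic search; no irrationality claim unless kernel-certified. MODEL objects
under Brown–Zudilin's (28)+(30) accounting ([BZ22] = arXiv:2210.03391); nothing here is a statement about `ζ(5)`;
records in print UNMOVED. Infrastructure for the cell's `BARRIER-PLAN.md` §2b (item (P1) of the «provable now»
list; theory seat cert-2 g17, WAKE w3 of lead/lit g23), part 2/2: the saving exponent `N_a(u)` of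
`ConeGammaDefs.savingN` is the value of ONE step function `𝒩` on `ℝ⁸`, evaluated along the line `u ↦ u·s(a)`
(`s(a) = sParam a`; at height `s₀ = 1` this is §2b's `u·ω(t)`).

* `torusTerm θ σ = Σ_{i∈F} (⌊φ_i θ⌋ − ⌊φ_i(σ·θ)⌋)`, **`torusN θ = max_σ torusTerm θ σ`** — the torus saving function;
  **`savingN_eq_torusN`**: `savingN a u = torusN (u • sParam a)` whenever every `σ` is admissible (always on the
  closed box: `savingN_eq_torusN_of_BZBox`) — the bridge asked for in §2b, through `sum_FIdx_h28`.
* `torusTerm_eq_fract` (17-term fractional-part form), `torusTerm_eq_compl` (the 11-term `F^c` form of the lane's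
  `W(π) − W(π₀)`), `torusTerm_eq_eight` (the Hamiltonian-path form: `F^c` minus the `{0,j}` pairs is the path
  3–5–4–6–1–7–2 of `K₇` = indices `hamIdx`, and the seven `{0,j}` terms collapse to the two path ends `{0,2},{0,3}`
  = indices `endIdx`: a difference of two sums of EIGHT fractional parts), hence **`torusN_nonneg`**,
  **`torusN_le_seven`** (`0 ≤ 𝒩 ≤ 7`, integer-valued by construction) and `savingN_le_seven_of_BZBox`.
* `torusN_congr_floor` — `𝒩` depends on `θ` only through the integer parts `⌊pairForm θ i j⌋`, `i ≠ j`: it is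
  constant on every cell of the hyperplane arrangement `{φ_e ∈ ℤ}` (piecewise constant);
  **`torusN_add_of_pairInt`** — `𝒩(θ + ζ) = 𝒩(θ)` whenever the pair forms of `ζ` are integers, in particular for
  `ζ ∈ ℤ⁸` (**`torusN_add_intVec`**: `𝒩` lives on `T⁸`) and for `ζ = T·s(a)` with `T·h_k(a) ∈ ℤ` for all `k`,
  which gives **`savingN_add_period`**: `N_a(u + T) = N_a(u)` — the `λ`-periodicity of the orbit at a rational
  direction of level `λ` that the exact period formula (P3) rests on; `savingN_realDir_add_one` (integer parameter
  vectors: period `1`, the census's `∫₀¹ N ψ′` normalisation).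
Not here (honest): the sharp cap `𝒩 ≤ 5` observed by the lane (R2′) — a finite cell enumeration, not attempted.
-/

noncomputable section

open Finset Set
open scoped Pointwise

namespace Summit.KontsevichZagierPeriods.Zeta5Search.Barrier.ConeGamma

/-! ### The torus saving function -/

/-- The contribution of `σ ∈ S₇` at `θ`: `Σ_{i∈F} (⌊φ_i(θ)⌋ − ⌊φ_i(σ·θ)⌋)` (no admissibility guard: on the box every
`σ` is admissible, `admissible_of_BZBox`). -/
def torusTerm (θ : Fin 8 → ℝ) (σ : Equiv.Perm (Fin 7)) : ℤ :=
  ∑ i ∈ FIdx, (⌊phiForm θ i⌋ - ⌊phiForm (permS σ θ) i⌋)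

/-- **The torus saving function `𝒩(θ) = max_{σ∈S₇} torusTerm θ σ`** (BARRIER-PLAN §2b): ONE step function on `ℝ⁸`,
`ℤ⁸`-periodic (`torusN_add_intVec`), with `N_a(u) = 𝒩(u·s(a))` (`savingN_eq_torusN`). -/
def torusN (θ : Fin 8 → ℝ) : ℤ :=
  (Finset.univ : Finset (Equiv.Perm (Fin 7))).sup' Finset.univ_nonempty (torusTerm θ)

open scoped Classical in
/-- The tree's `savingTerm` is the torus term along the line `u ↦ u·s(a)`, for admissible `σ`. -/
theorem savingTerm_eq_torusTerm {a : Dir} {σ : Equiv.Perm (Fin 7)} (hσ : Admissible a σ) (u : ℝ) :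
    savingTerm a u σ = torusTerm (u • sParam a) σ := by
  unfold savingTerm torusTerm
  rw [if_pos hσ]
  refine Finset.sum_congr rfl fun i _ => ?_
  rw [phiForm_smul_sParam, phiForm_permS_smul_sParam, mul_comm u, mul_comm u]

/-- **BRIDGE (P1)**: `N_a(u) = 𝒩(u·s(a))` whenever every `σ ∈ S₇` is admissible at `a`. -/
theorem savingN_eq_torusN {a : Dir} (hadm : ∀ σ, Admissible a σ) (u : ℝ) :
    savingN a u = torusN (u • sParam a) := by
  unfold savingN torusN
  congr 1
  ext σ
  exact savingTerm_eq_torusTerm (hadm σ) u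

/-- **BRIDGE on the closed box**: `N_a(u) = 𝒩(u·s(a))` for `a ∈ BZBox`. -/
theorem savingN_eq_torusN_of_BZBox {a : Dir} (ha : BZBox a) (u : ℝ) : savingN a u = torusN (u • sParam a) :=
  savingN_eq_torusN (admissible_of_BZBox ha) u

/-- The identity of `S₇` contributes `0`. -/
theorem torusTerm_one (θ : Fin 8 → ℝ) : torusTerm θ 1 = 0 := by
  unfold torusTerm
  exact Finset.sum_eq_zero fun i _ => by simp [permS_one]

/-- **`0 ≤ 𝒩`**. -/
theorem torusN_nonneg (θ : Fin 8 → ℝ) : 0 ≤ torusN θ := by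
  rw [← torusTerm_one θ]
  exact Finset.le_sup' (torusTerm θ) (Finset.mem_univ 1)

/-! ### Fractional-part forms: `F` (17 terms), `F^c` (11 terms), Hamiltonian path (8 + 8 terms) -/

/-- **17-term form**: `torusTerm θ σ = Σ_{i∈F} ({φ_i(σθ)} − {φ_i(θ)})` (the floors reduce to fractional parts
because `Σ_{i∈F} φ_i` is `S₇`-invariant). -/
theorem torusTerm_eq_fract (θ : Fin 8 → ℝ) (σ : Equiv.Perm (Fin 7)) :
    (torusTerm θ σ : ℝ) = ∑ i ∈ FIdx, (Int.fract (phiForm (permS σ θ) i) - Int.fract (phiForm θ i)) := by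
  unfold torusTerm
  push_cast
  have h := sum_FIdx_phiForm_permS σ θ
  simp only [Int.fract, Finset.sum_sub_distrib] at *
  linarith

/-- **11-term `F^c` form**: `torusTerm θ σ = Σ_{i∉F} ({φ_i(θ)} − {φ_i(σθ)})` (the sum of all 28 fractional parts
is `S₇`-invariant, `sum_univ_phiForm_permS`). -/
theorem torusTerm_eq_compl (θ : Fin 8 → ℝ) (σ : Equiv.Perm (Fin 7)) :
    (torusTerm θ σ : ℝ) = ∑ i ∈ FIdxᶜ, (Int.fract (phiForm θ i) - Int.fract (phiForm (permS σ θ) i)) := by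
  rw [torusTerm_eq_fract]
  have hall := sum_univ_phiForm_permS Int.fract σ θ
  rw [← Finset.sum_add_sum_compl FIdx, ← Finset.sum_add_sum_compl FIdx (fun k => Int.fract (phiForm θ k))]
    at hall
  simp only [Finset.sum_sub_distrib]
  linarith

/-- The six `{i,j}`-forms of `F^c` with `i, j ≥ 1`: indices `{7,18,20,21,24,25}` = pairs
`{3,5},{4,6},{1,6},{1,7},{4,5},{2,7}` = the Hamiltonian path `3–5–4–6–1–7–2` of `K₇`. -/
def hamIdx : Finset (Fin 28) := {7, 18, 20, 21, 24, 25}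

/-- The two `{0,j}`-forms in `F`: indices `{1,3}` = pairs `{0,2},{0,3}` (the ends of the path). -/
def endIdx : Finset (Fin 28) := {1, 3}

/-- All seven `{0,j}`-forms: indices `{1,3,11,12,14,16,23}`. -/
def zeroIdx : Finset (Fin 28) := {1, 3, 11, 12, 14, 16, 23}

/-- The sum of the seven `{0,j}` fractional parts is `S₇`-invariant. -/
theorem sum_zeroIdx_fract_permS (σ : Equiv.Perm (Fin 7)) (θ : Fin 8 → ℝ) :
    ∑ i ∈ zeroIdx, Int.fract (phiForm (permS σ θ) i) = ∑ i ∈ zeroIdx, Int.fract (phiForm θ i) := by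
  have h1 : ∑ i ∈ zeroIdx, Int.fract (phiForm (permS σ θ) i) = ∑ j : Fin 7, Int.fract (θ 0 - θ (σ j).succ) := by
    simp [zeroIdx, phiForm_permS, fstIdx, sndIdx, pairForm, Fin.sum_univ_seven]
    ring
  have h2 : ∑ i ∈ zeroIdx, Int.fract (phiForm θ i) = ∑ j : Fin 7, Int.fract (θ 0 - θ j.succ) := by
    simp [zeroIdx, phiForm_eq, fstIdx, sndIdx, pairForm, Fin.sum_univ_seven]
    ring
  rw [h1, h2]
  exact Equiv.sum_comp σ (fun j => Int.fract (θ 0 - θ j.succ))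

/-- **Hamiltonian-path form (8 + 8 terms)**:
`torusTerm θ σ = (Σ_{ham} {φ(θ)} + Σ_{ends} {φ(σθ)}) − (Σ_{ham} {φ(σθ)} + Σ_{ends} {φ(θ)})`. -/
theorem torusTerm_eq_eight (θ : Fin 8 → ℝ) (σ : Equiv.Perm (Fin 7)) :
    (torusTerm θ σ : ℝ) =
      (∑ i ∈ hamIdx, Int.fract (phiForm θ i) + ∑ i ∈ endIdx, Int.fract (phiForm (permS σ θ) i)) -
      (∑ i ∈ hamIdx, Int.fract (phiForm (permS σ θ) i) + ∑ i ∈ endIdx, Int.fract (phiForm θ i)) := by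
  rw [torusTerm_eq_compl]
  have hz := sum_zeroIdx_fract_permS σ θ
  have hcompl : FIdxᶜ = hamIdx ∪ ({11, 12, 14, 16, 23} : Finset (Fin 28)) := by decide
  have hzero : zeroIdx = endIdx ∪ ({11, 12, 14, 16, 23} : Finset (Fin 28)) := by decide
  have hd1 : Disjoint hamIdx ({11, 12, 14, 16, 23} : Finset (Fin 28)) := by decide
  have hd2 : Disjoint endIdx ({11, 12, 14, 16, 23} : Finset (Fin 28)) := by decide
  rw [hcompl, Finset.sum_union hd1]
  rw [hzero, Finset.sum_union hd2, Finset.sum_union hd2] at hz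
  simp only [Finset.sum_sub_distrib]
  linarith

/-- A sum of fractional parts over `s` lies in `[0, #s)`; here only the two bounds we need. -/
theorem sum_fract_nonneg (s : Finset (Fin 28)) (f : Fin 28 → ℝ) : 0 ≤ ∑ i ∈ s, Int.fract (f i) :=
  Finset.sum_nonneg fun _ _ => Int.fract_nonneg _

/-- A sum of fractional parts over a non-empty `s` is `< #s`. -/
theorem sum_fract_lt_card {s : Finset (Fin 28)} (hs : s.Nonempty) (f : Fin 28 → ℝ) :
    ∑ i ∈ s, Int.fract (f i) < s.card := by
  calc ∑ i ∈ s, Int.fract (f i) < ∑ _i ∈ s, (1 : ℝ) :=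
        Finset.sum_lt_sum_of_nonempty hs fun i _ => Int.fract_lt_one _
    _ = s.card := by simp

/-- **`torusTerm ≤ 7`** (a difference of two sums of eight fractional parts is `< 8`, and it is an integer). -/
theorem torusTerm_le_seven (θ : Fin 8 → ℝ) (σ : Equiv.Perm (Fin 7)) : torusTerm θ σ ≤ 7 := by
  have h := torusTerm_eq_eight θ σ
  have h1 := sum_fract_lt_card (s := hamIdx) (by decide) (phiForm θ)
  have h2 := sum_fract_lt_card (s := endIdx) (by decide) (phiForm (permS σ θ))
  have h3 := sum_fract_nonneg hamIdx (phiForm (permS σ θ))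
  have h4 := sum_fract_nonneg endIdx (phiForm θ)
  have hc1 : (hamIdx.card : ℝ) = 6 := by exact_mod_cast (by decide : hamIdx.card = 6)
  have hc2 : (endIdx.card : ℝ) = 2 := by exact_mod_cast (by decide : endIdx.card = 2)
  have hlt : (torusTerm θ σ : ℝ) < 8 := by rw [h]; linarith
  have : torusTerm θ σ < 8 := by exact_mod_cast hlt
  omega

/-- `−7 ≤ torusTerm` (same argument). -/
theorem neg_seven_le_torusTerm (θ : Fin 8 → ℝ) (σ : Equiv.Perm (Fin 7)) : -7 ≤ torusTerm θ σ := by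
  have h := torusTerm_eq_eight θ σ
  have h1 := sum_fract_lt_card (s := hamIdx) (by decide) (phiForm (permS σ θ))
  have h2 := sum_fract_lt_card (s := endIdx) (by decide) (phiForm θ)
  have h3 := sum_fract_nonneg hamIdx (phiForm θ)
  have h4 := sum_fract_nonneg endIdx (phiForm (permS σ θ))
  have hc1 : (hamIdx.card : ℝ) = 6 := by exact_mod_cast (by decide : hamIdx.card = 6)
  have hc2 : (endIdx.card : ℝ) = 2 := by exact_mod_cast (by decide : endIdx.card = 2)
  have hlt : (-8 : ℝ) < torusTerm θ σ := by rw [h]; linarith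
  have : -8 < torusTerm θ σ := by exact_mod_cast hlt
  omega

/-- **`𝒩 ≤ 7`**. -/
theorem torusN_le_seven (θ : Fin 8 → ℝ) : torusN θ ≤ 7 :=
  Finset.sup'_le _ _ fun σ _ => torusTerm_le_seven θ σ

/-- **On the closed box `0 ≤ N_a(u) ≤ 7`** for every real `u`. -/
theorem savingN_le_seven_of_BZBox {a : Dir} (ha : BZBox a) (u : ℝ) : savingN a u ≤ 7 := by
  rw [savingN_eq_torusN_of_BZBox ha]; exact torusN_le_seven _

/-! ### Periodicity and piecewise constancy -/

/-- **`𝒩` is constant on the cells of the arrangement `{pairForm i j ∈ ℤ}`**: it depends on `θ` only through the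
integer parts `⌊pairForm θ i j⌋`, `i ≠ j` (piecewise constant; the walls are the hyperplanes `φ_e ∈ ℤ`). -/
theorem torusN_congr_floor {θ θ' : Fin 8 → ℝ} (h : ∀ i j, i ≠ j → ⌊pairForm θ i j⌋ = ⌊pairForm θ' i j⌋) :
    torusN θ = torusN θ' := by
  unfold torusN torusTerm
  congr 1
  ext σ
  refine Finset.sum_congr rfl fun k _ => ?_
  rw [phiForm_permS, phiForm_permS, phiForm_eq, phiForm_eq, h _ _ (fstIdx_ne_sndIdx k),
    h _ _ ((liftPerm σ).injective.ne (fstIdx_ne_sndIdx k))]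

/-- Periodicity of each torus term. -/
theorem torusTerm_add_of_pairInt {θ ζ : Fin 8 → ℝ} (hζ : ∀ i j, i ≠ j → ∃ z : ℤ, pairForm ζ i j = z)
    (σ : Equiv.Perm (Fin 7)) : torusTerm (θ + ζ) σ = torusTerm θ σ := by
  have hk : ∀ k, ∃ z : ℤ, phiForm ζ k = z := fun k => by
    rw [phiForm_eq]; exact hζ _ _ (fstIdx_ne_sndIdx k)
  have hk' : ∀ k, ∃ z : ℤ, phiForm (permS σ ζ) k = z := fun k => by
    rw [phiForm_permS]; exact hζ _ _ ((liftPerm σ).injective.ne (fstIdx_ne_sndIdx k))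
  choose z hz using hk
  choose z' hz' using hk'
  have hsum : ∑ i ∈ FIdx, ((z i : ℝ) - z' i) = 0 := by
    rw [Finset.sum_congr rfl fun i _ => by rw [← hz i, ← hz' i], Finset.sum_sub_distrib,
      sum_FIdx_phiForm_permS, sub_self]
  have hmain : (torusTerm (θ + ζ) σ : ℝ) = torusTerm θ σ + ∑ i ∈ FIdx, ((z i : ℝ) - z' i) := by
    unfold torusTerm
    push_cast
    rw [← Finset.sum_add_distrib]
    refine Finset.sum_congr rfl fun i _ => ?_
    rw [phiForm_add, permS_add, phiForm_add, hz i, hz' i, Int.floor_add_intCast, Int.floor_add_intCast]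
    push_cast
    ring
  rw [hsum, add_zero] at hmain
  exact_mod_cast hmain

/-- **Periodicity (P1)**: `𝒩(θ + ζ) = 𝒩(θ)` whenever all pair forms of `ζ` (distinct indices) are integers — the
walls `φ_e ∈ ℤ` of the arrangement are invariant under such translations. -/
theorem torusN_add_of_pairInt {θ ζ : Fin 8 → ℝ} (hζ : ∀ i j, i ≠ j → ∃ z : ℤ, pairForm ζ i j = z) :
    torusN (θ + ζ) = torusN θ := by
  unfold torusN
  congr 1
  ext σ
  exact torusTerm_add_of_pairInt hζ σ

/-- **`ℤ⁸`-periodicity**: `𝒩` descends to the torus `T⁸ = ℝ⁸/ℤ⁸`. -/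
theorem torusN_add_intVec (θ : Fin 8 → ℝ) (z : Fin 8 → ℤ) :
    torusN (θ + fun i => (z i : ℝ)) = torusN θ := by
  apply torusN_add_of_pairInt
  intro i j _
  unfold pairForm
  split_ifs
  · exact ⟨z 0 - z j, by push_cast; ring⟩
  · exact ⟨z 0 - z i, by push_cast; ring⟩
  · exact ⟨z i + z j, by push_cast; ring⟩

/-- **Period of the orbit at a rational direction**: if `T·h_k(a) ∈ ℤ` for all 28 forms (e.g. `T = λ` for a
direction of level `λ`, or `T = 1` for an integer parameter vector) and every `σ` is admissible, then
`N_a(u + T) = N_a(u)` for every real `u`. -/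
theorem savingN_add_period {a : Dir} (hadm : ∀ σ, Admissible a σ) {T : ℝ}
    (hT : ∀ k : Fin 28, ∃ z : ℤ, T * h28 a k = z) (u : ℝ) : savingN a (u + T) = savingN a u := by
  rw [savingN_eq_torusN hadm, savingN_eq_torusN hadm, add_smul]
  apply torusN_add_of_pairInt
  apply pairInt_of_phiForm_int
  intro k
  rw [phiForm_smul_sParam]
  exact hT k

/-- The period on the closed box. -/
theorem savingN_add_period_of_BZBox {a : Dir} (ha : BZBox a) {T : ℝ}
    (hT : ∀ k : Fin 28, ∃ z : ℤ, T * h28 a k = z) (u : ℝ) : savingN a (u + T) = savingN a u :=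
  savingN_add_period (admissible_of_BZBox ha) hT u

/-- **Integer parameter vectors have period `1`**: `N_a(u + 1) = N_a(u)` (census's `∫₀¹ N ψ′` normalisation). -/
theorem savingN_realDir_add_one {a : Fin 8 → ℤ} (hadm : ∀ σ, Admissible (realDir a) σ) (u : ℝ) :
    savingN (realDir a) (u + 1) = savingN (realDir a) u :=
  savingN_add_period hadm (fun k => ⟨Literature.NumberTheory.Irrationality.BrownZudilin2022.hForm a (k + 1),
    by rw [one_mul, h28_realDir]⟩) u

end Summit.KontsevichZagierPeriods.Zeta5Search.Barrier.ConeGamma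

end
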